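import Mathlib
import Summits.ValiantsHypothesis.ValiantsHypothesis.Theorems.BarrierLeverPartitionMinorsHitByVPHiddenStatesSymbolic

/-!
# Route BarrierLever — item `PartitionMinorsHitByVP` (stmt-ValiantsHypothesis-19717), line `hidden-states`:
# TILTED CUBES I — Möbius bookkeeping on the Boolean lattice of `Fin d`

Helper file (`--supports stmt-ValiantsHypothesis-19717`; cell valiant-natproofs, rung V4, 𝒟-side door (c), registered line
`Cruxes/PartitionMinorsHitByVP/Lines/hidden_states.lean` v7; prover seat val-np-p6 gen 12). Definition-free; closes NO item.

Small linear-algebra facts on functions `f : Finset (Fin d) → ℂ` used by the TILT theorem (`…HiddenStatesTiltCore`): the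
superset-sum transform `T ↦ Σ_{A ⊇ T} f A` is injective (`eq_zero_of_sum_supersets`), a function whose superset sums vanish at
every PROPER subset is a multiple of the parity function (`eq_parity_of_sum_supersets`), the signed superset sum
`Σ_{A ⊇ T} (−1)^{d−|A|} = [T = univ]` (`sum_supersets_neg_one_pow`), and the quadratic moment of the parity function above a
co-doubleton: `Σ_{A ⊇ univ∖{a,b}} (−1)^{d−|A|} |A|² = 2` (`parity_quadratic_moment`) — the single number that carries the tilt
theorem (it is `(d−2)² − 2(d−1)² + d²`).

WHAT THIS IS NOT: bookkeeping; nothing on crux 14610 or VP ≠ VNP.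
-/

set_option linter.dupNamespace false

namespace Summit.ValiantsHypothesis.ValiantsHypothesis.Theorems.BarrierLever.HiddenStates

open Finset

noncomputable section

namespace Tilt

variable {d : ℕ}

/-- **Superset sums determine the function**: if `Σ_{A ⊇ T} f A = 0` for every `T`, then `f = 0`. -/
theorem eq_zero_of_sum_supersets (f : Finset (Fin d) → ℂ)
    (hf : ∀ T : Finset (Fin d), ∑ A ∈ Finset.univ.filter (fun A => T ⊆ A), f A = 0) : ∀ A, f A = 0 := by
  classical
  -- downward induction on the cardinality of the complement
  suffices H : ∀ n : ℕ, ∀ A : Finset (Fin d), d - A.card = n → f A = 0 from fun A => H _ A rfl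
  intro n
  induction n using Nat.strong_induction_on with
  | _ n ih =>
    intro A hA
    have hsplit : ∑ A' ∈ Finset.univ.filter (fun A' => A ⊆ A'), f A'
        = f A + ∑ A' ∈ (Finset.univ.filter (fun A' => A ⊆ A')).erase A, f A' := by
      rw [Finset.add_sum_erase]
      exact Finset.mem_filter.mpr ⟨Finset.mem_univ _, subset_refl A⟩
    have hrest : ∑ A' ∈ (Finset.univ.filter (fun A' => A ⊆ A')).erase A, f A' = 0 := by
      refine Finset.sum_eq_zero fun A' hA' => ?_
      obtain ⟨hne, hmem⟩ := Finset.mem_erase.mp hA'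
      have hsub : A ⊆ A' := (Finset.mem_filter.mp hmem).2
      have hss : A ⊂ A' := lt_of_le_of_ne hsub (Ne.symm hne)
      have hcard : A.card < A'.card := Finset.card_lt_card hss
      have hle : A'.card ≤ d := by simpa using Finset.card_le_univ A'
      exact ih (d - A'.card) (by omega) A' rfl
    have := hf A
    rw [hsplit, hrest, add_zero] at this
    exact this

/-- **The signed superset sum**: `Σ_{A ⊇ T} (−1)^{d − |A|} = [T = univ]`. -/
theorem sum_supersets_neg_one_pow (T : Finset (Fin d)) :
    ∑ A ∈ Finset.univ.filter (fun A => T ⊆ A), (-1 : ℂ) ^ (d - A.card) = if T = Finset.univ then 1 else 0 := by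
  classical
  -- substitute `A = univ \ E` with `E ⊆ univ \ T`
  have hbij : ∑ A ∈ Finset.univ.filter (fun A => T ⊆ A), (-1 : ℂ) ^ (d - A.card)
      = ∑ E ∈ (Finset.univ \ T).powerset, (-1 : ℂ) ^ E.card := by
    refine Finset.sum_bij (fun A _ => Finset.univ \ A) ?_ ?_ ?_ ?_
    · intro A hA
      exact Finset.mem_powerset.mpr (Finset.sdiff_subset_sdiff subset_rfl (Finset.mem_filter.mp hA).2)
    · intro A hA A' hA' hAA'
      have := congrArg (fun E => Finset.univ \ E) hAA'
      simpa [Finset.sdiff_sdiff_eq_self (Finset.subset_univ _)] using this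
    · intro E hE
      refine ⟨Finset.univ \ E, Finset.mem_filter.mpr ⟨Finset.mem_univ _, ?_⟩, ?_⟩
      · intro x hx
        rw [Finset.mem_sdiff]
        exact ⟨Finset.mem_univ _, fun hxE => (Finset.mem_sdiff.mp (Finset.mem_powerset.mp hE hxE)).2 hx⟩
      · exact Finset.sdiff_sdiff_eq_self (Finset.subset_univ _)
    · intro A hA
      rw [Finset.card_sdiff_of_subset (Finset.subset_univ _), Finset.card_univ, Fintype.card_fin]
  have hbin : ∑ E ∈ (Finset.univ \ T).powerset, (-1 : ℂ) ^ E.card = (-1 + 1 : ℂ) ^ (Finset.univ \ T).card := by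
    rw [← Finset.sum_pow_mul_eq_add_pow]
    exact Finset.sum_congr rfl fun E _ => by rw [one_pow, mul_one]
  rw [hbij, hbin]
  by_cases hT : T = Finset.univ
  · simp [hT]
  · rw [if_neg hT]
    have hne : (Finset.univ \ T).card ≠ 0 := by
      intro h0
      apply hT
      rw [Finset.card_eq_zero, Finset.sdiff_eq_empty_iff_subset] at h0
      exact Finset.Subset.antisymm (Finset.subset_univ _) h0
    rw [show (-1 + 1 : ℂ) = 0 by norm_num, zero_pow hne]

/-- **Parity**: if the superset sums of `f` vanish at every proper subset, then `f A = (−1)^{d−|A|} · f univ`. -/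
theorem eq_parity_of_sum_supersets (f : Finset (Fin d) → ℂ)
    (hf : ∀ T : Finset (Fin d), T ≠ Finset.univ → ∑ A ∈ Finset.univ.filter (fun A => T ⊆ A), f A = 0) :
    ∀ A, f A = (-1 : ℂ) ^ (d - A.card) * f Finset.univ := by
  classical
  have hβ := eq_zero_of_sum_supersets (fun A => f A - (-1 : ℂ) ^ (d - A.card) * f Finset.univ) (by
    intro T
    rw [Finset.sum_sub_distrib, ← Finset.sum_mul, sum_supersets_neg_one_pow]
    by_cases hT : T = Finset.univ
    · rw [if_pos hT, one_mul, hT]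
      have : Finset.univ.filter (fun A : Finset (Fin d) => Finset.univ ⊆ A) = {Finset.univ} := by
        ext A
        simp only [Finset.mem_filter, Finset.mem_univ, true_and, Finset.mem_singleton]
        exact ⟨fun h => Finset.Subset.antisymm (Finset.subset_univ A) h, fun h => h ▸ subset_rfl⟩
      rw [this, Finset.sum_singleton, sub_self]
    · rw [if_neg hT, zero_mul, sub_zero, hf T hT])
  intro A
  exact sub_eq_zero.mp (hβ A)

/-- **The quadratic moment of the parity function above a co-doubleton** (`a ≠ b`):
`Σ_{A ⊇ univ ∖ {a,b}} (−1)^{d − |A|} · |A|² = 2`. -/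
theorem parity_quadratic_moment (a b : Fin d) (hab : a ≠ b) :
    ∑ A ∈ Finset.univ.filter (fun A => Finset.univ \ {a, b} ⊆ A), (-1 : ℂ) ^ (d - A.card) * ((A.card : ℂ) ^ 2) = 2 := by
  classical
  set T₀ : Finset (Fin d) := Finset.univ \ {a, b} with hT₀
  have hd : 2 ≤ d := by
    have : ({a, b} : Finset (Fin d)).card ≤ Fintype.card (Fin d) := Finset.card_le_univ _
    rw [Finset.card_pair hab, Fintype.card_fin] at this; exact this
  have hT₀c : T₀.card = d - 2 := by
    rw [hT₀, Finset.card_sdiff_of_subset (Finset.subset_univ _), Finset.card_univ, Fintype.card_fin, Finset.card_pair hab]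
  have haT : a ∉ T₀ := by simp [hT₀]
  have hbT : b ∉ T₀ := by simp [hT₀]
  -- the four supersets of `T₀`
  have hsup : Finset.univ.filter (fun A => T₀ ⊆ A) = {T₀, insert a T₀, insert b T₀, Finset.univ} := by
    ext A
    simp only [Finset.mem_filter, Finset.mem_univ, true_and, Finset.mem_insert, Finset.mem_singleton]
    constructor
    · intro hA
      by_cases ha : a ∈ A <;> by_cases hb : b ∈ A
      · right; right; right
        refine Finset.Subset.antisymm (Finset.subset_univ A) fun x _ => ?_
        by_cases hxa : x = a
        · exact hxa ▸ ha
        by_cases hxb : x = b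
        · exact hxb ▸ hb
        exact hA (by simp [hT₀, hxa, hxb])
      · right; left
        ext x
        simp only [Finset.mem_insert, hT₀, Finset.mem_sdiff, Finset.mem_univ, true_and, Finset.mem_singleton, not_or]
        constructor
        · intro hx
          by_cases hxa : x = a
          · exact Or.inl hxa
          · exact Or.inr ⟨hxa, fun hxb => hb (hxb ▸ hx)⟩
        · rintro (rfl | ⟨hxa, hxb⟩)
          · exact ha
          · exact hA (by simp [hT₀, hxa, hxb])
      · right; right; left
        ext x
        simp only [Finset.mem_insert, hT₀, Finset.mem_sdiff, Finset.mem_univ, true_and, Finset.mem_singleton, not_or]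
        constructor
        · intro hx
          by_cases hxb : x = b
          · exact Or.inl hxb
          · exact Or.inr ⟨fun hxa => ha (hxa ▸ hx), hxb⟩
        · rintro (rfl | ⟨hxa, hxb⟩)
          · exact hb
          · exact hA (by simp [hT₀, hxa, hxb])
      · left
        refine Finset.Subset.antisymm ?_ hA
        intro x hx
        simp only [hT₀, Finset.mem_sdiff, Finset.mem_univ, true_and, Finset.mem_insert, Finset.mem_singleton, not_or]
        exact ⟨fun hxa => ha (hxa ▸ hx), fun hxb => hb (hxb ▸ hx)⟩
    · rintro (rfl | rfl | rfl | rfl)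
      · exact subset_rfl
      · exact Finset.subset_insert _ _
      · exact Finset.subset_insert _ _
      · exact Finset.subset_univ _
  rw [hsup]
  have h1 : T₀ ≠ insert a T₀ := fun h => haT (h ▸ Finset.mem_insert_self a T₀)
  have h2 : T₀ ≠ insert b T₀ := fun h => hbT (h ▸ Finset.mem_insert_self b T₀)
  have h3 : T₀ ≠ Finset.univ := fun h => haT (h ▸ Finset.mem_univ a)
  have h4 : insert a T₀ ≠ insert b T₀ := by
    intro h
    have : a ∈ insert b T₀ := h ▸ Finset.mem_insert_self a T₀
    rcases Finset.mem_insert.mp this with h' | h'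
    · exact hab h'
    · exact haT h'
  have h5 : insert a T₀ ≠ Finset.univ := by
    intro h
    have : b ∈ insert a T₀ := h ▸ Finset.mem_univ b
    rcases Finset.mem_insert.mp this with h' | h'
    · exact hab h'.symm
    · exact hbT h'
  have h6 : insert b T₀ ≠ Finset.univ := by
    intro h
    have : a ∈ insert b T₀ := h ▸ Finset.mem_univ a
    rcases Finset.mem_insert.mp this with h' | h'
    · exact hab h'
    · exact haT h'
  rw [Finset.sum_insert (by simp [h1, h2, h3]), Finset.sum_insert (by simp [h4, h5]), Finset.sum_pair h6,
    Finset.card_insert_of_notMem haT, Finset.card_insert_of_notMem hbT, hT₀c, Finset.card_univ, Fintype.card_fin]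
  have e1 : d - (d - 2) = 2 := by omega
  have e2 : d - (d - 2 + 1) = 1 := by omega
  rw [e1, e2, Nat.sub_self]
  have hcast : ((d - 2 : ℕ) : ℂ) = (d : ℂ) - 2 := by rw [Nat.cast_sub hd]; norm_num
  push_cast
  rw [hcast]
  ring

end Tilt

end

end Summit.ValiantsHypothesis.ValiantsHypothesis.Theorems.BarrierLever.HiddenStates
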